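import Literature.Analysis.FluidPDE.PassiveScalarEnergySlice
import Literature.Analysis.FluidPDE.SeisDissipationRateBoundProofs
import Literature.Analysis.FunctionSpaces.SpaceTimeWeakCompactness
import Literature.Analysis.FunctionSpaces.TorusScalarTrigPoly
import Literature.Analysis.FunctionSpaces.TorusAxisAverage
import Literature.Analysis.FunctionSpaces.TorusSpaceTimeFields
import HarnessLib

/-!
# Weak lower semicontinuity of the time-integrated scalar dissipation

Analysis/FluidPDE proof-support file (everything proved). If fields `θⱼ ∈ L^∞(0,T; L²(T^d))`,
uniformly bounded, converge **weakly** in `L²((0,T) × T^d)` to `W` (pairings against every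
square-integrable `G` converge — the output of the tree's weak-* extraction
`Torus.exists_strictMono_weakLimit_of_lintegral_sq_le`), then the time-integrated spectral
dissipation is lower semicontinuous:

  `∫⁻_{(0,T)} eScalarGradNormSq (W t) ≤ liminfⱼ ∫⁻_{(0,T)} eScalarGradNormSq (θⱼ t)`
  (`lintegral_eScalarGradNormSq_le_liminf_of_weakLimit`).

Proof (Fourier side; Robinson–Rodrigo–Sadowski 2016, Lemma 4.5 / (4.19): norms are weakly lower
semicontinuous): `∫⁻ eScalarGradNormSq = 4π² ∑ₖ |k|² ∫₀ᵀ |θ̂(t,k)|² dt`; for each frequency the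
cosine/sine coefficients `t ↦ ∫ θⱼ(t) Re e_{-k}`, `∫ θⱼ(t) Im e_{-k}` converge weakly in
`L²(0,T)` (test against `g(t) Re e_{-k}(x)`), whence `∫|Ŵ(k)|² ≤ liminf ∫|θ̂ⱼ(k)|²` by
Cauchy–Schwarz; Fatou for the series concludes.

## References

* J. C. Robinson, J. L. Rodrigo, W. Sadowski, *The three-dimensional Navier–Stokes equations*,
  CUP (2016), Lemma 4.5, (4.19). [`RobinsonRodrigoSadowski2016`]
-/

noncomputable section

open MeasureTheory Set Filter Topology Function UnitAddTorus
open scoped ENNReal NNReal InnerProductSpace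
open Literature.Analysis.FunctionSpaces Literature.Analysis.FunctionSpaces.Torus

namespace Literature.Analysis.FluidPDE

namespace Torus

variable {d : Type*} [Fintype d]

/-! ## Fatou-type lemmas for `liminf` in `ℝ≥0∞` -/

omit [Fintype d] in
/-- `c * liminf u ≤ liminf (c * u)` in `ℝ≥0∞`. [folklore] -/
theorem _root_.ENNReal.mul_liminf_le (c : ℝ≥0∞) (u : ℕ → ℝ≥0∞) :
    c * liminf u atTop ≤ liminf (fun n => c * u n) atTop := by
  rw [liminf_eq_iSup_iInf_of_nat, liminf_eq_iSup_iInf_of_nat, ENNReal.mul_iSup]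
  refine iSup_mono fun n => ?_
  exact le_iInf₂ fun i hi => mul_le_mul_right (iInf₂_le i hi) c

omit [Fintype d] in
/-- `liminf u + liminf v ≤ liminf (u + v)` in `ℝ≥0∞`. [folklore] -/
theorem _root_.ENNReal.liminf_add_le_liminf_add (u v : ℕ → ℝ≥0∞) :
    liminf u atTop + liminf v atTop ≤ liminf (fun n => u n + v n) atTop := by
  rw [liminf_eq_iSup_iInf_of_nat, liminf_eq_iSup_iInf_of_nat, liminf_eq_iSup_iInf_of_nat]
  have hm1 : Monotone fun n => ⨅ i ≥ n, u i := fun a b hab => le_iInf₂ fun i hi => iInf₂_le i (hab.trans hi)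
  have hm2 : Monotone fun n => ⨅ i ≥ n, v i := fun a b hab => le_iInf₂ fun i hi => iInf₂_le i (hab.trans hi)
  rw [ENNReal.iSup_add_iSup_of_monotone hm1 hm2]
  refine iSup_mono fun n => ?_
  exact le_iInf₂ fun i hi => add_le_add (iInf₂_le i hi) (iInf₂_le i hi)

omit [Fintype d] in
/-- Finite sums of `liminf`s are below the `liminf` of the sums (`ℝ≥0∞`). [folklore] -/
theorem _root_.ENNReal.sum_liminf_le {ι : Type*} (S : Finset ι) (g : ℕ → ι → ℝ≥0∞) :
    ∑ k ∈ S, liminf (fun n => g n k) atTop ≤ liminf (fun n => ∑ k ∈ S, g n k) atTop := by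
  classical
  induction S using Finset.induction_on with
  | empty => simp
  | insert a S ha ih =>
    rw [Finset.sum_insert ha]
    refine (add_le_add le_rfl ih).trans ?_
    refine (ENNReal.liminf_add_le_liminf_add _ _).trans (le_of_eq ?_)
    refine liminf_congr (Eventually.of_forall fun n => ?_)
    rw [Finset.sum_insert ha]

omit [Fintype d] in
/-- **Fatou's lemma for series with `liminf`** in `ℝ≥0∞`:
`∑' k, liminf_n g n k ≤ liminf_n ∑' k, g n k`. [folklore] -/
theorem _root_.ENNReal.tsum_liminf_le_liminf_tsum {ι : Type*} (g : ℕ → ι → ℝ≥0∞) :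
    ∑' k, liminf (fun n => g n k) atTop ≤ liminf (fun n => ∑' k, g n k) atTop := by
  rw [ENNReal.tsum_eq_iSup_sum]
  refine iSup_le fun S => (ENNReal.sum_liminf_le S g).trans ?_
  exact liminf_le_liminf (Eventually.of_forall fun n => ENNReal.sum_le_tsum S)

/-! ## Weak lower semicontinuity of an `L²(0,T)` pair norm -/

omit [Fintype d] in
/-- Cauchy–Schwarz in `ℝ²`: `a c + b d ≤ √(a² + b²) √(c² + d²)`. [folklore] -/
theorem _root_.Real.add_mul_le_sqrt_mul_sqrt (a b c e : ℝ) :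
    a * c + b * e ≤ Real.sqrt (a ^ 2 + b ^ 2) * Real.sqrt (c ^ 2 + e ^ 2) := by
  rw [← Real.sqrt_mul (by positivity)]
  refine Real.le_sqrt_of_sq_le ?_
  nlinarith [sq_nonneg (a * e - b * c)]

omit [Fintype d] in
/-- **Lower semicontinuity from weak convergence and Cauchy–Schwarz.** If `Xⱼ → A`, `0 ≤ A`,
`Xⱼ ≤ √A · √Aⱼ` with `Aⱼ ≥ 0`, then `ofReal A ≤ liminf ofReal Aⱼ`. [folklore] -/
theorem _root_.ENNReal.ofReal_le_liminf_of_tendsto_of_le_sqrt_mul {X A' : ℕ → ℝ} {A : ℝ} (hA : 0 ≤ A)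
    (hA' : ∀ j, 0 ≤ A' j) (hX : Tendsto X atTop (𝓝 A)) (hle : ∀ j, X j ≤ Real.sqrt A * Real.sqrt (A' j)) :
    ENNReal.ofReal A ≤ liminf (fun j => ENNReal.ofReal (A' j)) atTop := by
  by_contra hlt
  rw [not_le] at hlt
  obtain ⟨r, hr1, hr2⟩ := exists_between hlt
  have hrtop : r ≠ ∞ := (hr2.trans ENNReal.ofReal_lt_top).ne
  have hfreq : ∃ᶠ j in atTop, ENNReal.ofReal (A' j) < r := frequently_lt_of_liminf_lt (by isBoundedDefault) hr1
  set r' : ℝ := r.toReal with hr'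
  have hr'A : r' < A := by
    have := (ENNReal.lt_ofReal_iff_toReal_lt hrtop).1 hr2
    exact this
  have hr'0 : 0 ≤ r' := ENNReal.toReal_nonneg
  -- along the frequent indices, `X j ≤ √A √r'`, while `X j → A`
  have hApos : 0 < A := lt_of_le_of_lt hr'0 hr'A
  have hgap : 0 < A - Real.sqrt A * Real.sqrt r' := by
    have h1 : Real.sqrt r' < Real.sqrt A := Real.sqrt_lt_sqrt hr'0 hr'A
    have h2 : Real.sqrt A * Real.sqrt r' < Real.sqrt A * Real.sqrt A :=
      mul_lt_mul_of_pos_left h1 (Real.sqrt_pos.2 hApos)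
    rw [Real.mul_self_sqrt hA] at h2
    linarith
  have hev : ∀ᶠ j in atTop, A - (A - Real.sqrt A * Real.sqrt r') / 2 < X j := by
    have := (tendsto_order.1 hX).1 (A - (A - Real.sqrt A * Real.sqrt r') / 2) (by linarith)
    exact this
  obtain ⟨j, hj1, hj2⟩ := (hfreq.and_eventually hev).exists
  have hAj : A' j < r' := by
    have := (ENNReal.ofReal_lt_iff_lt_toReal (hA' j) hrtop).1 hj1
    exact this
  have h3 : X j ≤ Real.sqrt A * Real.sqrt r' :=
    (hle j).trans (mul_le_mul_of_nonneg_left (Real.sqrt_le_sqrt hAj.le) (Real.sqrt_nonneg _))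
  linarith

/-! ## Time coefficient functions of a space–time field -/

section Coeff

variable {T : ℝ}

omit [Fintype d] in
/-- Measurability of `t ↦ ∫ θ(t,x) R(x) dx` for a jointly measurable `θ` and continuous `R`. [folklore] -/
theorem aestronglyMeasurable_integral_mul_slice [Fintype d] {θ : ℝ → UnitAddTorus d → ℝ} {R : UnitAddTorus d → ℝ}
    (hθ : AEStronglyMeasurable (uncurry θ) ((volume.restrict (Ioo 0 T)).prod volume)) (hR : Continuous R) :
    AEStronglyMeasurable (fun t => ∫ x, θ t x * R x) (volume.restrict (Ioo 0 T)) :=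
  (hθ.mul (hR.measurable.comp measurable_snd).aestronglyMeasurable).integral_prod_right'

/-- A bound for the torus trigonometric modes `Re e_{-k}`, `Im e_{-k}` of the tree
(`reTrigPoly {-k}`): `|·| ≤ 1`. [folklore] -/
theorem abs_reTrigPoly_singleton_le (k : d → ℤ) (c : ℂ) (hc : ‖c‖ ≤ 1) (x : UnitAddTorus d) :
    |reTrigPoly {-k} (fun _ => c) x| ≤ 1 := by
  rw [reTrigPoly_singleton_apply]
  refine (Complex.abs_re_le_norm _).trans ?_
  rw [norm_mul]
  calc ‖(mFourier (-k) x : ℂ)‖ * ‖c‖ ≤ 1 * 1 :=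
        mul_le_mul (((mFourier (-k)).norm_coe_le_norm x).trans_eq mFourier_norm) hc (norm_nonneg _) zero_le_one
    _ = 1 := one_mul 1

omit [Fintype d] in
/-- Slice bound: if `∫⁻ ‖θ(t)‖ₑ² ≤ C` and `|R| ≤ 1` then `|∫ θ(t) R| ≤ √C`. [folklore] -/
theorem abs_integral_mul_le_sqrt_of_lintegral_sq_le [Fintype d] {f R : UnitAddTorus d → ℝ} (hf : AEStronglyMeasurable f volume)
    {C : ℝ≥0} (hC : ∫⁻ x, ‖f x‖ₑ ^ 2 ≤ C) (hR : ∀ x, |R x| ≤ 1) :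
    |∫ x, f x * R x| ≤ Real.sqrt C := by
  have hf2 : MemLp f 2 volume := by
    refine ⟨hf, ?_⟩
    rw [eLpNorm_eq_lintegral_rpow_enorm_toReal two_ne_zero ENNReal.ofNat_ne_top]
    simp only [ENNReal.toReal_ofNat, ENNReal.rpow_two, one_div]
    exact ENNReal.rpow_lt_top_of_nonneg (by norm_num) (lt_of_le_of_lt hC ENNReal.coe_lt_top).ne
  have h1 : |∫ x, f x * R x| ≤ ∫ x, |f x| := by
    refine (abs_integral_le_integral_abs).trans (integral_mono_of_nonneg (Eventually.of_forall fun x => abs_nonneg _)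
      (hf2.integrable one_le_two).abs (Eventually.of_forall fun x => ?_))
    show |f x * R x| ≤ |f x|
    rw [abs_mul]
    exact mul_le_of_le_one_right (abs_nonneg _) (hR x)
  refine h1.trans ((integral_abs_le_sqrt_integral_sq hf2).trans (Real.sqrt_le_sqrt ?_))
  have e : ∫ x, f x ^ 2 = (∫⁻ x, ‖f x‖ₑ ^ 2).toReal := by
    rw [integral_eq_lintegral_of_nonneg_ae (Eventually.of_forall fun x => sq_nonneg _)
      ((hf.aemeasurable.pow_const 2).aestronglyMeasurable)]
    congr 1
    exact lintegral_congr fun x => by rw [← Real.enorm_eq_ofReal (sq_nonneg _), enorm_pow]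
  rw [e]
  exact ENNReal.toReal_le_coe_of_le_coe hC

end Coeff

/-! ## The coefficientwise lower semicontinuity -/

section Main

variable {T : ℝ} {C : ℝ≥0} {θ : ℕ → ℝ → UnitAddTorus d → ℝ} {W : ℝ → UnitAddTorus d → ℝ}

/-- **Weak convergence of the time coefficient functions**: for continuous `R` with `|R| ≤ 1`
and `g ∈ L^∞(0,T)` measurable, `∫₀ᵀ g(t) (∫ θⱼ(t) R) dt → ∫₀ᵀ g(t) (∫ W(t) R) dt`. [folklore] -/
theorem tendsto_integral_mul_coeff
    (hlim : ∀ G : ℝ → UnitAddTorus d → ℝ,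
      AEStronglyMeasurable (stLift G) (volume.restrict (Ioo 0 T ×ˢ univ)) →
      ∫⁻ t in Ioo 0 T, ∫⁻ x, ‖G t x‖ₑ ^ 2 < ∞ →
      Tendsto (fun j => ∫ t in Ioo 0 T, ∫ x, θ j t x * G t x) atTop (𝓝 (∫ t in Ioo 0 T, ∫ x, W t x * G t x)))
    {R : UnitAddTorus d → ℝ} (hR : Continuous R) (hR1 : ∀ x, |R x| ≤ 1)
    {g : ℝ → ℝ} (hgm : AEStronglyMeasurable g (volume.restrict (Ioo 0 T))) {B : ℝ}
    (hgB : ∀ᵐ t ∂(volume.restrict (Ioo 0 T)), |g t| ≤ B) :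
    Tendsto (fun j => ∫ t in Ioo 0 T, g t * ∫ x, θ j t x * R x) atTop
      (𝓝 (∫ t in Ioo 0 T, g t * ∫ x, W t x * R x)) := by
  set G : ℝ → UnitAddTorus d → ℝ := fun t x => g t * R x with hG
  have e : ∀ (f : UnitAddTorus d → ℝ) (t : ℝ), ∫ x, f x * G t x = g t * ∫ x, f x * R x := fun f t => by
    simp only [hG]
    rw [← integral_const_mul]
    exact integral_congr_ae (Eventually.of_forall fun x => by ring)
  have hGm : AEStronglyMeasurable (uncurry G) ((volume.restrict (Ioo 0 T)).prod volume) :=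
    (hgm.comp_quasiMeasurePreserving (Measure.quasiMeasurePreserving_fst)).mul
      (hR.measurable.comp measurable_snd).aestronglyMeasurable
  have hGst : AEStronglyMeasurable (stLift G) (volume.restrict (Ioo 0 T ×ˢ univ)) :=
    aestronglyMeasurable_stLift_of_uncurry hGm
  have hG2 : ∫⁻ t in Ioo 0 T, ∫⁻ x, ‖G t x‖ₑ ^ 2 < ∞ := by
    have hB0 : ∀ᵐ t ∂(volume.restrict (Ioo 0 T)), ∫⁻ x, ‖G t x‖ₑ ^ 2 ≤ ENNReal.ofReal (max B 0) ^ 2 := by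
      filter_upwards [hgB] with t ht
      calc ∫⁻ x, ‖G t x‖ₑ ^ 2 ≤ ∫⁻ _ : UnitAddTorus d, ENNReal.ofReal (max B 0) ^ 2 := by
            refine lintegral_mono fun x => ?_
            gcongr
            rw [hG, ← ofReal_norm, norm_mul, Real.norm_eq_abs, Real.norm_eq_abs]
            exact ENNReal.ofReal_le_ofReal ((mul_le_of_le_one_right (abs_nonneg _) (hR1 x)).trans
              (ht.trans (le_max_left _ _)))
        _ = ENNReal.ofReal (max B 0) ^ 2 := by rw [lintegral_const, measure_univ, mul_one]
    calc ∫⁻ t in Ioo 0 T, ∫⁻ x, ‖G t x‖ₑ ^ 2 ≤ ∫⁻ _ in Ioo (0 : ℝ) T, ENNReal.ofReal (max B 0) ^ 2 :=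
          lintegral_mono_ae hB0
      _ < ∞ := by
          rw [lintegral_const, Measure.restrict_apply_univ]
          exact ENNReal.mul_lt_top (ENNReal.pow_lt_top ENNReal.ofReal_lt_top) measure_Ioo_lt_top
  have h := hlim G hGst hG2
  simp_rw [e] at h
  exact h

/-- Measurability of `t ↦ θ̂(t, k)` for a jointly measurable real field. [folklore] -/
theorem aestronglyMeasurable_mFourierCoeff_ofReal_slice {η : ℝ → UnitAddTorus d → ℝ}
    (hη : AEStronglyMeasurable (uncurry η) ((volume.restrict (Ioo 0 T)).prod volume)) (k : d → ℤ) :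
    AEStronglyMeasurable (fun t => mFourierCoeff (fun x => (η t x : ℂ)) k) (volume.restrict (Ioo 0 T)) := by
  have hF : AEStronglyMeasurable (fun z : ℝ × UnitAddTorus d => (mFourier (-k) z.2 : ℂ) • ((η z.1 z.2 : ℝ) : ℂ))
      ((volume.restrict (Ioo 0 T)).prod volume) :=
    ((mFourier (-k)).continuous.aestronglyMeasurable.comp_snd).smul
      (Complex.continuous_ofReal.comp_aestronglyMeasurable hη)
  have e : (fun t => mFourierCoeff (fun x => (η t x : ℂ)) k) =
      fun t => ∫ y, (mFourier (-k) y : ℂ) • ((η t y : ℝ) : ℂ) :=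
    funext fun t => mFourierCoeff_eq_integral_volume _ _
  rw [e]
  exact hF.integral_prod_right'

/-- Slices of an `L^∞_t L²_x` field are square integrable, hence integrable, for a.e. `t`. [folklore] -/
theorem ae_integrable_slice_of_lintegral_sq_le {η : ℝ → UnitAddTorus d → ℝ}
    (hη : AEStronglyMeasurable (uncurry η) ((volume.restrict (Ioo 0 T)).prod volume))
    (hb : ∀ᵐ t ∂(volume.restrict (Ioo 0 T)), ∫⁻ x, ‖η t x‖ₑ ^ 2 ≤ C) :
    ∀ᵐ t ∂(volume.restrict (Ioo 0 T)), AEStronglyMeasurable (η t) volume ∧ Integrable (η t) volume := by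
  filter_upwards [hη.prodMk_left, hb] with t hm ht
  refine ⟨hm, ?_⟩
  have h2 : MemLp (η t) 2 volume := by
    refine ⟨hm, ?_⟩
    rw [eLpNorm_eq_lintegral_rpow_enorm_toReal two_ne_zero ENNReal.ofNat_ne_top]
    simp only [ENNReal.toReal_ofNat, ENNReal.rpow_two, one_div]
    exact ENNReal.rpow_lt_top_of_nonneg (by norm_num) (lt_of_le_of_lt ht ENNReal.coe_lt_top).ne
  exact h2.integrable one_le_two

/-- **Coefficientwise weak lower semicontinuity**: for every frequency `k`,
`∫₀ᵀ |Ŵ(t,k)|² dt ≤ liminfⱼ ∫₀ᵀ |θ̂ⱼ(t,k)|² dt`. [cite: RobinsonRodrigoSadowski2016, Lemma 4.5 (4.19)] -/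
theorem lintegral_enorm_sq_mFourierCoeff_le_liminf
    (hm : ∀ j, AEStronglyMeasurable (stLift (θ j)) (volume.restrict (Ioo 0 T ×ˢ univ)))
    (hb : ∀ j, ∀ᵐ t ∂(volume.restrict (Ioo 0 T)), ∫⁻ x, ‖θ j t x‖ₑ ^ 2 ≤ C)
    (hWm : AEStronglyMeasurable (stLift W) (volume.restrict (Ioo 0 T ×ˢ univ)))
    (hWb : ∀ᵐ t ∂(volume.restrict (Ioo 0 T)), ∫⁻ x, ‖W t x‖ₑ ^ 2 ≤ C)
    (hlim : ∀ G : ℝ → UnitAddTorus d → ℝ,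
      AEStronglyMeasurable (stLift G) (volume.restrict (Ioo 0 T ×ˢ univ)) →
      ∫⁻ t in Ioo 0 T, ∫⁻ x, ‖G t x‖ₑ ^ 2 < ∞ →
      Tendsto (fun j => ∫ t in Ioo 0 T, ∫ x, θ j t x * G t x) atTop (𝓝 (∫ t in Ioo 0 T, ∫ x, W t x * G t x)))
    (k : d → ℤ) :
    ∫⁻ t in Ioo 0 T, ‖mFourierCoeff (fun x => (W t x : ℂ)) k‖ₑ ^ 2 ≤
      liminf (fun j => ∫⁻ t in Ioo 0 T, ‖mFourierCoeff (fun x => (θ j t x : ℂ)) k‖ₑ ^ 2) atTop := by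
  classical
  set μT : Measure ℝ := volume.restrict (Ioo 0 T) with hμT
  haveI : IsFiniteMeasure μT := by rw [hμT]; infer_instance
  -- the two real modes
  set R : UnitAddTorus d → ℝ := reTrigPoly {-k} (fun _ => 1) with hR
  set I : UnitAddTorus d → ℝ := reTrigPoly {-k} (fun _ => -Complex.I) with hI
  have hRc : Continuous R := continuous_reTrigPoly _ _
  have hIc : Continuous I := continuous_reTrigPoly _ _
  have hR1 : ∀ x, |R x| ≤ 1 := abs_reTrigPoly_singleton_le k 1 (by simp)
  have hI1 : ∀ x, |I x| ≤ 1 := abs_reTrigPoly_singleton_le k (-Complex.I) (by simp)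
  -- measurability and slices
  have hθu : ∀ j, AEStronglyMeasurable (uncurry (θ j)) (μT.prod volume) := fun j =>
    aestronglyMeasurable_uncurry_of_stLift_prod (hm j)
  have hWu : AEStronglyMeasurable (uncurry W) (μT.prod volume) := aestronglyMeasurable_uncurry_of_stLift_prod hWm
  -- the coefficient functions
  set p : ℕ → ℝ → ℝ := fun j t => ∫ x, θ j t x * R x with hp
  set q : ℕ → ℝ → ℝ := fun j t => ∫ x, θ j t x * I x with hq
  set pW : ℝ → ℝ := fun t => ∫ x, W t x * R x with hpW
  set qW : ℝ → ℝ := fun t => ∫ x, W t x * I x with hqW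
  have hpm : ∀ j, AEStronglyMeasurable (p j) μT := fun j => aestronglyMeasurable_integral_mul_slice (hθu j) hRc
  have hqm : ∀ j, AEStronglyMeasurable (q j) μT := fun j => aestronglyMeasurable_integral_mul_slice (hθu j) hIc
  have hpWm : AEStronglyMeasurable pW μT := aestronglyMeasurable_integral_mul_slice hWu hRc
  have hqWm : AEStronglyMeasurable qW μT := aestronglyMeasurable_integral_mul_slice hWu hIc
  set B : ℝ := Real.sqrt C with hB
  have hpb : ∀ j, ∀ᵐ t ∂μT, |p j t| ≤ B ∧ |q j t| ≤ B := fun j => by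
    filter_upwards [(hθu j).prodMk_left, hb j] with t hmt hbt
    exact ⟨abs_integral_mul_le_sqrt_of_lintegral_sq_le hmt hbt hR1, abs_integral_mul_le_sqrt_of_lintegral_sq_le hmt hbt hI1⟩
  have hpWb : ∀ᵐ t ∂μT, |pW t| ≤ B ∧ |qW t| ≤ B := by
    filter_upwards [hWu.prodMk_left, hWb] with t hmt hbt
    exact ⟨abs_integral_mul_le_sqrt_of_lintegral_sq_le hmt hbt hR1, abs_integral_mul_le_sqrt_of_lintegral_sq_le hmt hbt hI1⟩
  -- the squared coefficients
  have hsq : ∀ {η : ℝ → UnitAddTorus d → ℝ}, AEStronglyMeasurable (uncurry η) (μT.prod volume) →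
      (∀ᵐ t ∂μT, ∫⁻ x, ‖η t x‖ₑ ^ 2 ≤ C) →
      ∀ᵐ t ∂μT, ‖mFourierCoeff (fun x => (η t x : ℂ)) k‖ₑ ^ 2 =
        ENNReal.ofReal ((∫ x, η t x * R x) ^ 2 + (∫ x, η t x * I x) ^ 2) := by
    intro η hη hηb
    filter_upwards [ae_integrable_slice_of_lintegral_sq_le hη hηb] with t ht
    rw [← sq_norm_mFourierCoeff_ofReal ht.2 k, ← ofReal_norm, ← ENNReal.ofReal_pow (norm_nonneg _)]
  -- real forms of the time integrals
  set A' : ℕ → ℝ := fun j => ∫ t, (p j t ^ 2 + q j t ^ 2) ∂μT with hA'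
  set A : ℝ := ∫ t, (pW t ^ 2 + qW t ^ 2) ∂μT with hA
  have hbdd : ∀ {f g : ℝ → ℝ}, AEStronglyMeasurable f μT → AEStronglyMeasurable g μT →
      (∀ᵐ t ∂μT, |f t| ≤ B ∧ |g t| ≤ B) → Integrable (fun t => f t ^ 2 + g t ^ 2) μT := by
    intro f g hf hg hfg
    refine Integrable.mono' (integrable_const (B ^ 2 + B ^ 2)) ((hf.pow 2).add (hg.pow 2)) ?_
    filter_upwards [hfg] with t ht
    rw [Real.norm_eq_abs, abs_of_nonneg (by positivity)]
    have h1 : f t ^ 2 ≤ B ^ 2 := by rw [← sq_abs]; exact pow_le_pow_left₀ (abs_nonneg _) ht.1 2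
    have h2 : g t ^ 2 ≤ B ^ 2 := by rw [← sq_abs]; exact pow_le_pow_left₀ (abs_nonneg _) ht.2 2
    linarith
  have hconv : ∀ {η : ℝ → UnitAddTorus d → ℝ} {f g : ℝ → ℝ}, AEStronglyMeasurable f μT → AEStronglyMeasurable g μT →
      (∀ᵐ t ∂μT, |f t| ≤ B ∧ |g t| ≤ B) →
      (∀ᵐ t ∂μT, ‖mFourierCoeff (fun x => (η t x : ℂ)) k‖ₑ ^ 2 = ENNReal.ofReal (f t ^ 2 + g t ^ 2)) →
      ∫⁻ t, ‖mFourierCoeff (fun x => (η t x : ℂ)) k‖ₑ ^ 2 ∂μT = ENNReal.ofReal (∫ t, (f t ^ 2 + g t ^ 2) ∂μT) := by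
    intro η f g hf hg hfg he
    rw [lintegral_congr_ae he, ofReal_integral_eq_lintegral_ofReal (hbdd hf hg hfg)
      (Eventually.of_forall fun t => by positivity)]
  have haj : ∀ j, ∫⁻ t, ‖mFourierCoeff (fun x => (θ j t x : ℂ)) k‖ₑ ^ 2 ∂μT = ENNReal.ofReal (A' j) := fun j =>
    hconv (hpm j) (hqm j) (hpb j) (hsq (hθu j) (hb j))
  have haW : ∫⁻ t, ‖mFourierCoeff (fun x => (W t x : ℂ)) k‖ₑ ^ 2 ∂μT = ENNReal.ofReal A :=
    hconv hpWm hqWm hpWb (hsq hWu hWb)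
  -- weak convergence of the pairings
  have hX : Tendsto (fun j => ∫ t, (pW t * p j t + qW t * q j t) ∂μT) atTop (𝓝 A) := by
    have h1 := tendsto_integral_mul_coeff hlim hRc hR1 hpWm (hpWb.mono fun t ht => ht.1)
    have h2 := tendsto_integral_mul_coeff hlim hIc hI1 hqWm (hpWb.mono fun t ht => ht.2)
    have i1 : ∀ j, Integrable (fun t => pW t * p j t) μT := fun j => by
      refine Integrable.mono' (integrable_const (B * B)) (hpWm.mul (hpm j)) ?_
      filter_upwards [hpWb, hpb j] with t h1 h2
      rw [norm_mul, Real.norm_eq_abs, Real.norm_eq_abs]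
      exact mul_le_mul h1.1 h2.1 (abs_nonneg _) ((abs_nonneg _).trans h1.1)
    have i2 : ∀ j, Integrable (fun t => qW t * q j t) μT := fun j => by
      refine Integrable.mono' (integrable_const (B * B)) (hqWm.mul (hqm j)) ?_
      filter_upwards [hpWb, hpb j] with t h1 h2
      rw [norm_mul, Real.norm_eq_abs, Real.norm_eq_abs]
      exact mul_le_mul h1.2 h2.2 (abs_nonneg _) ((abs_nonneg _).trans h1.2)
    have i1W : Integrable (fun t => pW t * pW t) μT := by
      refine Integrable.mono' (integrable_const (B * B)) (hpWm.mul hpWm) ?_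
      filter_upwards [hpWb] with t h1
      rw [norm_mul, Real.norm_eq_abs]
      exact mul_le_mul h1.1 h1.1 (abs_nonneg _) ((abs_nonneg _).trans h1.1)
    have i2W : Integrable (fun t => qW t * qW t) μT := by
      refine Integrable.mono' (integrable_const (B * B)) (hqWm.mul hqWm) ?_
      filter_upwards [hpWb] with t h1
      rw [norm_mul, Real.norm_eq_abs]
      exact mul_le_mul h1.2 h1.2 (abs_nonneg _) ((abs_nonneg _).trans h1.2)
    have h12 := h1.add h2
    rw [← integral_add i1W i2W] at h12
    have e1 : (fun j => (∫ t, pW t * p j t ∂μT) + ∫ t, qW t * q j t ∂μT) = fun j => ∫ t, (pW t * p j t + qW t * q j t) ∂μT :=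
      funext fun j => (integral_add (i1 j) (i2 j)).symm
    rw [e1] at h12
    have e2 : (fun t => pW t * pW t + qW t * qW t) = fun t => pW t ^ 2 + qW t ^ 2 := by funext t; ring
    rwa [e2] at h12
  -- Cauchy–Schwarz in `L²(0,T)`
  have hCS : ∀ j, ∫ t, (pW t * p j t + qW t * q j t) ∂μT ≤ Real.sqrt A * Real.sqrt (A' j) := by
    intro j
    set F : ℝ → ℝ := fun t => Real.sqrt (pW t ^ 2 + qW t ^ 2) with hF
    set G : ℝ → ℝ := fun t => Real.sqrt (p j t ^ 2 + q j t ^ 2) with hG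
    have hFm : AEStronglyMeasurable F μT :=
      (Real.continuous_sqrt.measurable.comp_aemeasurable ((hpWm.pow 2).add (hqWm.pow 2)).aemeasurable).aestronglyMeasurable
    have hGm : AEStronglyMeasurable G μT :=
      (Real.continuous_sqrt.measurable.comp_aemeasurable (((hpm j).pow 2).add ((hqm j).pow 2)).aemeasurable).aestronglyMeasurable
    have hF2 : MemLp F 2 μT := by
      refine MemLp.of_bound hFm (Real.sqrt (B ^ 2 + B ^ 2)) ?_
      filter_upwards [hpWb] with t ht
      rw [Real.norm_eq_abs, abs_of_nonneg (Real.sqrt_nonneg _)]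
      refine Real.sqrt_le_sqrt ?_
      have h1 : pW t ^ 2 ≤ B ^ 2 := by rw [← sq_abs]; exact pow_le_pow_left₀ (abs_nonneg _) ht.1 2
      have h2 : qW t ^ 2 ≤ B ^ 2 := by rw [← sq_abs]; exact pow_le_pow_left₀ (abs_nonneg _) ht.2 2
      linarith
    have hG2 : MemLp G 2 μT := by
      refine MemLp.of_bound hGm (Real.sqrt (B ^ 2 + B ^ 2)) ?_
      filter_upwards [hpb j] with t ht
      rw [Real.norm_eq_abs, abs_of_nonneg (Real.sqrt_nonneg _)]
      refine Real.sqrt_le_sqrt ?_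
      have h1 : p j t ^ 2 ≤ B ^ 2 := by rw [← sq_abs]; exact pow_le_pow_left₀ (abs_nonneg _) ht.1 2
      have h2 : q j t ^ 2 ≤ B ^ 2 := by rw [← sq_abs]; exact pow_le_pow_left₀ (abs_nonneg _) ht.2 2
      linarith
    have hpt : ∀ t, pW t * p j t + qW t * q j t ≤ F t * G t := fun t => Real.add_mul_le_sqrt_mul_sqrt _ _ _ _
    have iFG : Integrable (fun t => F t * G t) μT := by
      have := memLp_one_iff_integrable.1 (MemLp.mul (r := 1) hG2 hF2)
      exact this
    have i1 : Integrable (fun t => pW t * p j t) μT := by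
      refine Integrable.mono' (integrable_const (B * B)) (hpWm.mul (hpm j)) ?_
      filter_upwards [hpWb, hpb j] with t h1 h2
      rw [norm_mul, Real.norm_eq_abs, Real.norm_eq_abs]
      exact mul_le_mul h1.1 h2.1 (abs_nonneg _) ((abs_nonneg _).trans h1.1)
    have i2 : Integrable (fun t => qW t * q j t) μT := by
      refine Integrable.mono' (integrable_const (B * B)) (hqWm.mul (hqm j)) ?_
      filter_upwards [hpWb, hpb j] with t h1 h2
      rw [norm_mul, Real.norm_eq_abs, Real.norm_eq_abs]
      exact mul_le_mul h1.2 h2.2 (abs_nonneg _) ((abs_nonneg _).trans h1.2)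
    have hint : ∫ t, (pW t * p j t + qW t * q j t) ∂μT ≤ ∫ t, F t * G t ∂μT :=
      integral_mono (i1.add i2) iFG hpt
    refine hint.trans ?_
    have h := integral_mul_le_Lp_mul_Lq_of_nonneg Real.HolderConjugate.two_two
      (Eventually.of_forall fun t => Real.sqrt_nonneg _) (Eventually.of_forall fun t => Real.sqrt_nonneg _)
      (by rw [ENNReal.ofReal_ofNat]; exact hF2) (by rw [ENNReal.ofReal_ofNat]; exact hG2)
    refine h.trans (le_of_eq ?_)
    have eF : ∀ t, F t ^ (2 : ℝ) = pW t ^ 2 + qW t ^ 2 := fun t => by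
      rw [Real.rpow_two]; exact Real.sq_sqrt (by positivity)
    have eG : ∀ t, G t ^ (2 : ℝ) = p j t ^ 2 + q j t ^ 2 := fun t => by
      rw [Real.rpow_two]; exact Real.sq_sqrt (by positivity)
    show (∫ t, F t ^ (2 : ℝ) ∂μT) ^ (1 / (2 : ℝ)) * (∫ t, G t ^ (2 : ℝ) ∂μT) ^ (1 / (2 : ℝ)) = Real.sqrt A * Real.sqrt (A' j)
    simp_rw [eF, eG]
    rw [← Real.sqrt_eq_rpow, ← Real.sqrt_eq_rpow]
  -- conclusion
  rw [haW]
  simp_rw [haj]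
  exact ENNReal.ofReal_le_liminf_of_tendsto_of_le_sqrt_mul (integral_nonneg fun t => by positivity)
    (fun j => integral_nonneg fun t => by positivity) hX hCS

/-- **Weak lower semicontinuity of the time-integrated dissipation**: for `θⱼ ⇀ W` weakly in
`L²((0,T) × T^d)` with `θⱼ`, `W` bounded in `L^∞(0,T; L²)`,
`∫⁻_{(0,T)} eScalarGradNormSq (W t) ≤ liminfⱼ ∫⁻_{(0,T)} eScalarGradNormSq (θⱼ t)`.
[cite: RobinsonRodrigoSadowski2016, Lemma 4.5 (4.19)] -/
theorem lintegral_eScalarGradNormSq_le_liminf_of_weakLimit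
    (hm : ∀ j, AEStronglyMeasurable (stLift (θ j)) (volume.restrict (Ioo 0 T ×ˢ univ)))
    (hb : ∀ j, ∀ᵐ t ∂(volume.restrict (Ioo 0 T)), ∫⁻ x, ‖θ j t x‖ₑ ^ 2 ≤ C)
    (hWm : AEStronglyMeasurable (stLift W) (volume.restrict (Ioo 0 T ×ˢ univ)))
    (hWb : ∀ᵐ t ∂(volume.restrict (Ioo 0 T)), ∫⁻ x, ‖W t x‖ₑ ^ 2 ≤ C)
    (hlim : ∀ G : ℝ → UnitAddTorus d → ℝ,
      AEStronglyMeasurable (stLift G) (volume.restrict (Ioo 0 T ×ˢ univ)) →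
      ∫⁻ t in Ioo 0 T, ∫⁻ x, ‖G t x‖ₑ ^ 2 < ∞ →
      Tendsto (fun j => ∫ t in Ioo 0 T, ∫ x, θ j t x * G t x) atTop (𝓝 (∫ t in Ioo 0 T, ∫ x, W t x * G t x))) :
    ∫⁻ t in Ioo 0 T, eScalarGradNormSq (W t) ≤
      liminf (fun j => ∫⁻ t in Ioo 0 T, eScalarGradNormSq (θ j t)) atTop := by
  classical
  set c : ℝ≥0∞ := ENNReal.ofReal (4 * Real.pi ^ 2) with hc
  set w : (d → ℤ) → ℝ≥0∞ := fun k => ENNReal.ofReal (FunctionSpaces.Torus.freqNormSq k) with hw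
  -- the series form of the time integrals
  have hser : ∀ {η : ℝ → UnitAddTorus d → ℝ}, AEStronglyMeasurable (stLift η) (volume.restrict (Ioo 0 T ×ˢ univ)) →
      ∫⁻ t in Ioo 0 T, eScalarGradNormSq (η t) =
        c * ∑' k, w k * ∫⁻ t in Ioo 0 T, ‖mFourierCoeff (fun x => (η t x : ℂ)) k‖ₑ ^ 2 := by
    intro η hη
    have hηu := aestronglyMeasurable_uncurry_of_stLift_prod hη
    have hmeas : ∀ k, AEMeasurable (fun t => w k * ‖mFourierCoeff (fun x => (η t x : ℂ)) k‖ₑ ^ 2)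
        (volume.restrict (Ioo 0 T)) := fun k =>
      ((aestronglyMeasurable_mFourierCoeff_ofReal_slice hηu k).enorm.pow_const 2).const_mul _
    simp_rw [eScalarGradNormSq_eq_tsum]
    rw [lintegral_const_mul'' _ (AEMeasurable.tsum hmeas), lintegral_tsum hmeas]
    congr 1
    refine tsum_congr fun k => ?_
    rw [lintegral_const_mul'' _ ((aestronglyMeasurable_mFourierCoeff_ofReal_slice hηu k).enorm.pow_const 2)]
  rw [hser hWm]
  have e : (fun j => ∫⁻ t in Ioo 0 T, eScalarGradNormSq (θ j t)) =
      fun j => c * ∑' k, w k * ∫⁻ t in Ioo 0 T, ‖mFourierCoeff (fun x => (θ j t x : ℂ)) k‖ₑ ^ 2 :=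
    funext fun j => hser (hm j)
  rw [e]
  refine le_trans ?_ (ENNReal.mul_liminf_le c _)
  refine mul_le_mul_right ?_ c
  refine le_trans (ENNReal.tsum_le_tsum fun k => ?_) (ENNReal.tsum_liminf_le_liminf_tsum
    (fun j k => w k * ∫⁻ t in Ioo 0 T, ‖mFourierCoeff (fun x => (θ j t x : ℂ)) k‖ₑ ^ 2))
  exact (mul_le_mul_right (lintegral_enorm_sq_mFourierCoeff_le_liminf hm hb hWm hWb hlim k) (w k)).trans
    (ENNReal.mul_liminf_le (w k) _)

end Main

end Torus

end Literature.Analysis.FluidPDE
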